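import Literature.NumberTheory.DiophantineGeometry.AVIsogenyTateHomPositivityProofs
import Literature.NumberTheory.DiophantineGeometry.AVIsogenyTateFinrankHomCubeProofs
import Literature.NumberTheory.DiophantineGeometry.AVIsogenyTateEndAlgebraProofs
import HarnessLib

/-!
# Mumford §19, Theorem 3 and its corollaries from the theorem of the cube alone

`AVIsogenyTateHomPositivityProofs` proves `Hom(A, B)` finitely generated
(`AbelianVariety.module_finite_hom_of_theoremOfCube`) over any field from the Theorem of the Cube
(the named fact `theoremOfCube_linEquiv`, Görtz–Wedhorn II Thm. 24.73) alone — without Poincaré's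
reducibility theorem — via positive curve forms. This file records the resulting hypothesis-free (but
for the cube) forms of the whole cluster of named facts of `AVIsogenyTate` reduced to finite
generation in the sibling proof files, replacing the `hP1`/`hsimple`/`hP` hypotheses of
`AVIsogenyTateFinrankHomCubeProofs`, `…ClosureProofs`, `AVIsogenyTateInjectiveClosingProofs`:

* `AbelianVariety.module_free_hom_of_theoremOfCube` — `Hom(A, B)` is free (§19 Thm. 3 with Cor. 1):
  finitely generated and torsion-free (`[n]_A` an isogeny, `isIsogeny_zsmul_id_of_theoremOfCube_linEquiv`;
  `module_free_hom_of_module_finite_hom_of_isIsogeny_zsmul_id`);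
* `AbelianVariety.faltingsTateMap_injective_of_theoremOfCube` — injectivity of
  `ℤ_ℓ ⊗ Hom(A, B) → Hom_{Γ_K}(T_ℓ A, T_ℓ B)` for `ℓ ≠ char K` (§19 Thm. 3, second assertion;
  `faltingsTateMap_injective_of_module_finite_hom`, Milne 1986 Lemma 12.6);
* `AbelianVariety.finrank_hom_le_of_theoremOfCube` — `rank Hom(A, B) ≤ 4 dim A dim B` (§19 Cor. 1;
  `finrank_hom_le_of_module_finite_hom` with the torsion counts from the cube);
* `AbelianVariety.finiteDimensional_endAlgebra_of_theoremOfCube` — `End⁰(A)` is finite-dimensional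
  (§19 Cor. 1–2; `finiteDimensional_endAlgebra_of_module_finite_hom`);
* the same four from `cechComplex_pseudoCoherent_general` (Görtz–Wedhorn II Thm. 23.133 / Cor. 23.135,
  the single remaining unproved input: `theoremOfCube_linEquiv_of_pseudoCoherent_general`).

Hence the discharges `module_finite_hom_holds`, `module_free_hom_holds`, `faltingsTateMap_injective_holds`,
`finrank_hom_le_holds`, `finiteDimensional_endAlgebra_holds` are each one application of the theorems
below to `theoremOfCube_linEquiv_holds` (or `cechComplex_pseudoCoherent_general_holds`) once it lands.

## References

* [MumfordAV1970] D. Mumford, *Abelian Varieties* (1970): §19, Thm. 3 with Cor. 1–2 (pp. 176–178 of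
  the 2nd ed.). Not held; architecture as in Milne 1986.
* [Milne1986AbelianVarieties] J. S. Milne, *Abelian Varieties*, in Cornell–Silverman (eds.),
  *Arithmetic Geometry* (1986): Thm. 12.5, Lemma 12.6, Cor. 12.8 (held, PDF pp. 190–192).
* [GortzWedhorn2023] U. Görtz, T. Wedhorn, *Algebraic Geometry II* (2023): Thm. 24.73 (p. 550);
  Thm. 23.133 / Cor. 23.135 (pp. 478–480).

## Design

No definitions, no named facts (net debt 0); one-line compositions of theorems in the tree.
-/

universe u

open CategoryTheory

noncomputable section

namespace Literature.NumberTheory.DiophantineGeometry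

section AbelianVariety
open Literature.AlgebraicGeometry.Motives (AbelianVariety theoremOfCube_linEquiv
  cechComplex_pseudoCoherent_general theoremOfCube_linEquiv_of_pseudoCoherent_general)
open Literature.AlgebraicGeometry.Motives.AbelianVariety

variable {K : Type u} [Field K]

/-! ### From the Theorem of the Cube -/

/-- **`Hom(A, B)` is a free abelian group (Mumford §19 Thm. 3 with Cor. 1) from the Theorem of the
Cube alone**: finitely generated (`module_finite_hom_of_theoremOfCube`, no Poincaré reducibility) and
torsion-free since `[n]_A` is an isogeny (`isIsogeny_zsmul_id_of_theoremOfCube_linEquiv`), hence free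
over the PID `ℤ`. [cite: MumfordAV1970, §19 Thm. 3 and Cor. 1] -/
theorem _root_.Literature.AlgebraicGeometry.Motives.AbelianVariety.module_free_hom_of_theoremOfCube
    (hcube : theoremOfCube_linEquiv.{u}) (A B : AbelianVariety K) : module_free_hom A B :=
  module_free_hom_of_module_finite_hom_of_isIsogeny_zsmul_id
    (module_finite_hom_of_theoremOfCube hcube A B) (A.isIsogeny_zsmul_id_of_theoremOfCube_linEquiv hcube)

/-- **Mumford §19 Thm. 3, second assertion (injectivity of `ℤ_ℓ ⊗ Hom(A, B) → Hom_{Γ_K}(T_ℓ A, T_ℓ B)`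
for every prime `ℓ` invertible in `K`) from the Theorem of the Cube alone**: it follows from finite
generation (`faltingsTateMap_injective_of_module_finite_hom`, Milne 1986, proof of Thm. 12.5 with
Lemma 12.6). [cite: MumfordAV1970, §19 Thm. 3] [cite: Milne1986AbelianVarieties, Thm. 12.5 with Lemma 12.6 (PDF pp. 190–192)] -/
theorem _root_.Literature.AlgebraicGeometry.Motives.AbelianVariety.faltingsTateMap_injective_of_theoremOfCube
    (hcube : theoremOfCube_linEquiv.{u}) (A B : AbelianVariety K) : faltingsTateMap_injective A B :=
  faltingsTateMap_injective_of_module_finite_hom A B (module_finite_hom_of_theoremOfCube hcube A B)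

/-- **Mumford §19, Corollary 1 of Theorem 3 (`rank Hom(A, B) ≤ 4 dim A dim B`) from the Theorem of the
Cube alone**: `finrank_hom_le_of_module_finite_hom` with finite generation
(`module_finite_hom_of_theoremOfCube`) and the torsion counts `#A[n](K̄) = n^{2 dim A}` from the cube.
[cite: MumfordAV1970, §19 Cor. 1 of Thm. 3] -/
theorem _root_.Literature.AlgebraicGeometry.Motives.AbelianVariety.finrank_hom_le_of_theoremOfCube
    (hcube : theoremOfCube_linEquiv.{u}) (A B : AbelianVariety K) : finrank_hom_le A B :=
  finrank_hom_le_of_module_finite_hom A B (module_finite_hom_of_theoremOfCube hcube A B)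
    (A.natCard_torsionPoints_of_isAlgClosed_of_theoremOfCube_linEquiv (AlgebraicClosure K) hcube)
    (B.natCard_torsionPoints_of_isAlgClosed_of_theoremOfCube_linEquiv (AlgebraicClosure K) hcube)

/-- **`End⁰(A) = ℚ ⊗ End(A)` is a finite-dimensional `ℚ`-algebra (Mumford §19 Cor. 1–2 of Thm. 3) from
the Theorem of the Cube alone** (`finiteDimensional_endAlgebra_of_module_finite_hom`).
[cite: MumfordAV1970, §19 Cor. 1–2 of Thm. 3] -/
theorem _root_.Literature.AlgebraicGeometry.Motives.AbelianVariety.finiteDimensional_endAlgebra_of_theoremOfCube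
    (hcube : theoremOfCube_linEquiv.{u}) (A : AbelianVariety K) : finiteDimensional_endAlgebra A :=
  finiteDimensional_endAlgebra_of_module_finite_hom A (module_finite_hom_of_theoremOfCube hcube A A)

/-! ### From the pseudo-coherence of the Čech complex (the remaining leaf) -/

/-- `Hom(A, B)` free, from `cechComplex_pseudoCoherent_general` (Görtz–Wedhorn II Thm. 23.133).
[cite: GortzWedhorn2023, Thm. 24.73 (p. 550)] -/
theorem _root_.Literature.AlgebraicGeometry.Motives.AbelianVariety.module_free_hom_of_pseudoCoherent_general
    (h : cechComplex_pseudoCoherent_general.{u}) (A B : AbelianVariety K) : module_free_hom A B :=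
  module_free_hom_of_theoremOfCube (theoremOfCube_linEquiv_of_pseudoCoherent_general h) A B

/-- The Tate map is injective, from `cechComplex_pseudoCoherent_general`.
[cite: GortzWedhorn2023, Thm. 24.73 (p. 550)] -/
theorem _root_.Literature.AlgebraicGeometry.Motives.AbelianVariety.faltingsTateMap_injective_of_pseudoCoherent_general
    (h : cechComplex_pseudoCoherent_general.{u}) (A B : AbelianVariety K) : faltingsTateMap_injective A B :=
  faltingsTateMap_injective_of_theoremOfCube (theoremOfCube_linEquiv_of_pseudoCoherent_general h) A B

/-- `rank Hom(A, B) ≤ 4 dim A dim B`, from `cechComplex_pseudoCoherent_general`.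
[cite: GortzWedhorn2023, Thm. 24.73 (p. 550)] -/
theorem _root_.Literature.AlgebraicGeometry.Motives.AbelianVariety.finrank_hom_le_of_pseudoCoherent_general
    (h : cechComplex_pseudoCoherent_general.{u}) (A B : AbelianVariety K) : finrank_hom_le A B :=
  finrank_hom_le_of_theoremOfCube (theoremOfCube_linEquiv_of_pseudoCoherent_general h) A B

/-- `End⁰(A)` finite-dimensional, from `cechComplex_pseudoCoherent_general`.
[cite: GortzWedhorn2023, Thm. 24.73 (p. 550)] -/
theorem _root_.Literature.AlgebraicGeometry.Motives.AbelianVariety.finiteDimensional_endAlgebra_of_pseudoCoherent_general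
    (h : cechComplex_pseudoCoherent_general.{u}) (A : AbelianVariety K) : finiteDimensional_endAlgebra A :=
  finiteDimensional_endAlgebra_of_theoremOfCube (theoremOfCube_linEquiv_of_pseudoCoherent_general h) A

end AbelianVariety

end Literature.NumberTheory.DiophantineGeometry
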